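import Literature.NumberTheory.Automorphic.UnitaryCayleyChartDatum
import HarnessLib

/-!
# Chart data in TORUS COORDINATES: the torus factor of a regular orbit chart is the centraliser itself
# (N6ns-reg-(iv), CM dress — FILE 1b, field level; the form the (HLOC) junction reads)

Topic `NumberTheory/Automorphic`; namespace `Literature.NumberTheory.Automorphic`. THEOREMS ONLY (no definition, no instance, no notation, no named
fact, no `sorry`). Cell `pub/hodgecm-mathlib`, programme P3a, road «N6-ns», brick **N6ns-reg-(iv) CM DRESS** (LEAD F0P3a-plan (g9) T8-19 (D)(3), T8-25
(J-a); F0P2-p02 (g8) JUNCTION DESIGN REQUEST 02:40:25Z «`B := ↥(Subgroup.centralizer {γH})`, `τ := Subtype.val`»).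

GENERIC over the frame of ★ `UnitaryCayleyChartDatum.exists_box_of_chartDatum` (`U ≤ GL_n(E)`, `E` a `T₁` topological field): an ABSTRACT chart datum
`(e : OpenPartialHomeomorph (A × B) U, s, τ)` around the regular semisimple `γ = τ b₀` with `e = s·τ·s⁻¹` on its source, `s a₀ = 1`, `τ(B) ⊆ Z_U(γ)`, and the
BOX CLAUSE of ★ `exists_unitary_cayleyChartDatum` (compact-open boxes `K × B₁ ⊆ e.source` inside every neighbourhood of `(a₀, b₀)` with (reg) `χ(τ b)` separable
∧ `Z_U(τ b) = Z_U(γ)`, (SAT) `x τ(b) x⁻¹ ∈ e(K × B₁) ⇒ x ∈ s(K)·Z_U(γ)`, (SEP) `τ b ∼_{GL_n(E)} τ b′ ⇒ b = b′`) is RE-COORDINATISED so that the torus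
factor is the centraliser SUBGROUP `↥Z_U(γ)` with its subspace topology and `τ = Subtype.val`:

* §1 `exists_openPartialHomeomorph_torusCoordinate` — on a regular box `B₀` the torus coordinate `b ↦ ⟨τ b, _⟩ : B → ↥Z_U(γ)` is an OPEN EMBEDDING:
  for `O ⊆ B₀` open, `τ(O) = Z_U(γ) ∩ e(e.source ∩ (A × O)) ∩ R` for a rigidity neighbourhood `R ∋ γ`, because a point of `Z_U(γ) = Z_U(τ b)` near `γ`
  that is conjugate to `τ b` commutes with it and has its characteristic polynomial, hence EQUALS it — ★
  `CharpolyLocalRigidity.eventually_eq_of_commute_of_charpoly_eq`; Mathlib `OpenPartialHomeomorph.ofContinuousOpenRestrict` on `Set.InjOn.toPartialEquiv`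
  (injectivity on the box = (SEP) at equal points).
* §2 **`exists_torus_chartDatum_of_chartDatum`** — `eᵀ := ((refl A).prod ζ.symm).trans e : OpenPartialHomeomorph (A × ↥Z_U(γ)) U`, `eᵀ(a, t) = s a · t · (s a)⁻¹`
  on its source, base point `(a₀, t₀)` with `t₀ = γ`, and the box clause VERBATIM in the new coordinates (boxes `K × ζ(B₁)`, compact and open in `Z_U(γ)`).

HONEST SCOPE. Point-set topology and linear algebra. HC_CM is proved only modulo the printed citations until rung 0 closes; this file discharges no
printed statement.

## References
* [HarishChandra1970] Harish-Chandra (notes by G. van Dijk), *Harmonic Analysis on Reductive p-adic Groups*, LNM 162 (1970), Part I §3 (the map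
  `G/T × T′ → G` is a local homeomorphism at regular points).
* [Rogawski1990] J. D. Rogawski, *Automorphic Representations of Unitary Groups in Three Variables*, Ann. of Math. Stud. 123 (1990), §3.1 p. 19, §4.3 p. 43.
-/

set_option autoImplicit false

noncomputable section

open Set Filter Topology Polynomial
open Literature.LinearAlgebra.Matrix
open scoped Matrix MatrixGroups Pointwise

namespace Literature.NumberTheory.Automorphic

section Subgroup

variable {E : Type*} [Field E] [TopologicalSpace E] [IsTopologicalRing E] [T1Space E]
  {n : Type*} [Fintype n] [DecidableEq n] {U : Subgroup (GL n E)}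
  {A B : Type*} [TopologicalSpace A] [TopologicalSpace B]

/-- **The torus coordinate is an open embedding into the centraliser.** For an abstract chart datum `(e, s, τ)` on `U ≤ GL_n(E)` around the regular
semisimple `γ = τ b₀` (`e = s·τ·s⁻¹` on its source, `s a₀ = 1`, `τ(B) ⊆ Z_U(γ)`, box clause), there are an open `B₀ ∋ b₀` with `{a₀} × B₀ ⊆ e.source` and an
`OpenPartialHomeomorph ζ : B → ↥Z_U(γ)` with `ζ.source = B₀` and `ζ b = ⟨τ b, _⟩` for all `b`. [cite: HarishChandra1970, Part I §3] [cite: Rogawski1990, §3.1 p. 19] -/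
theorem exists_openPartialHomeomorph_torusCoordinate [Nonempty B] {γ : ↥U} (hγ : ((γ : GL n E) : Matrix n n E).charpoly.Separable)
    (s : A → ↥U) (τ : B → ↥U) (hτ : Continuous τ) (e : OpenPartialHomeomorph (A × B) ↥U)
    (he : ∀ p ∈ e.source, e p = s p.1 * τ p.2 * (s p.1)⁻¹) {a₀ : A} {b₀ : B}
    (hs₀ : s a₀ = 1) (hτ₀ : τ b₀ = γ) (hcomm : ∀ b, τ b ∈ Subgroup.centralizer ({γ} : Set ↥U))
    (hbox : ∀ N ∈ 𝓝 (a₀, b₀), ∃ (K : Set A) (B₁ : Set B), IsCompact K ∧ IsOpen K ∧ a₀ ∈ K ∧ IsCompact B₁ ∧ IsOpen B₁ ∧ b₀ ∈ B₁ ∧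
      K ×ˢ B₁ ⊆ N ∧ K ×ˢ B₁ ⊆ e.source ∧
      (∀ b ∈ B₁, (((τ b : ↥U) : GL n E) : Matrix n n E).charpoly.Separable ∧
        Subgroup.centralizer ({τ b} : Set ↥U) = Subgroup.centralizer ({γ} : Set ↥U)) ∧
      (∀ b ∈ B₁, ∀ x : ↥U, x * τ b * x⁻¹ ∈ e '' (K ×ˢ B₁) →
        x ∈ s '' K * (Subgroup.centralizer ({γ} : Set ↥U) : Set ↥U)) ∧
      (∀ b ∈ B₁, ∀ b' ∈ B₁, IsConj ((τ b : ↥U) : GL n E) ((τ b' : ↥U) : GL n E) → b = b')) :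
    ∃ (B₀ : Set B) (ζ : OpenPartialHomeomorph B ↥(Subgroup.centralizer ({γ} : Set ↥U))),
      IsOpen B₀ ∧ b₀ ∈ B₀ ∧ (∀ b ∈ B₀, (a₀, b) ∈ e.source) ∧ ζ.source = B₀ ∧
      ∀ b, ((ζ b : ↥(Subgroup.centralizer ({γ} : Set ↥U))) : ↥U) = τ b := by
  classical
  -- the rigidity neighbourhood `R ∋ γ` in `M_n(E)`
  have hrig := eventually_eq_of_commute_of_charpoly_eq ((γ : GL n E) : Matrix n n E) hγ
  obtain ⟨R₁, hR₁, R₂, hR₂, hR⟩ := mem_nhds_prod_iff.1 hrig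
  obtain ⟨R, hRsub, hRo, hγR⟩ := _root_.mem_nhds_iff.1 (inter_mem hR₁ hR₂)
  have hτm : Continuous fun b : B => (((τ b : ↥U) : GL n E) : Matrix n n E) :=
    Units.continuous_val.comp (continuous_subtype_val.comp hτ)
  have hNR : (fun b : B => (((τ b : ↥U) : GL n E) : Matrix n n E)) ⁻¹' R ∈ 𝓝 b₀ := by
    refine hτm.continuousAt.preimage_mem_nhds (hRo.mem_nhds ?_)
    show (((τ b₀ : ↥U) : GL n E) : Matrix n n E) ∈ R
    rw [hτ₀]
    exact hγR
  -- an initial regular box inside the rigidity neighbourhood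
  obtain ⟨K₀, B₀, -, -, haK₀, -, hB₀o, hbB₀, hKB₀N, hKB₀s, hreg₀, -, hsep₀⟩ :=
    hbox (univ ×ˢ ((fun b : B => (((τ b : ↥U) : GL n E) : Matrix n n E)) ⁻¹' R)) (prod_mem_nhds univ_mem hNR)
  have hB₀R : ∀ b ∈ B₀, (((τ b : ↥U) : GL n E) : Matrix n n E) ∈ R := fun b hb => (hKB₀N (mk_mem_prod haK₀ hb)).2
  have hB₀src : ∀ b ∈ B₀, (a₀, b) ∈ e.source := fun b hb => hKB₀s (mk_mem_prod haK₀ hb)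
  have hea₀ : ∀ b ∈ B₀, e (a₀, b) = τ b := fun b hb => by
    rw [he _ (hB₀src b hb), hs₀, inv_one, one_mul, mul_one]
  -- the torus coordinate into the centraliser, injective and open on `B₀`
  let ζf : B → ↥(Subgroup.centralizer ({γ} : Set ↥U)) := fun b => ⟨τ b, hcomm b⟩
  have hζc : Continuous ζf := hτ.subtype_mk _
  have hinj : InjOn ζf B₀ := fun b hb b' hb' h => by
    have h' : τ b = τ b' := congrArg Subtype.val h
    exact hsep₀ b hb b' hb' (by rw [h'])
  have hopen : IsOpenMap (B₀.restrict ζf) := by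
    intro O' hO'
    obtain ⟨O, hO, rfl⟩ := isOpen_induced_iff.1 hO'
    rw [Set.restrict_eq, Set.image_comp, Subtype.image_preimage_coe]
    have hVo : IsOpen (e '' (e.source ∩ Prod.snd ⁻¹' (B₀ ∩ O))) :=
      e.isOpen_image_source_inter ((hB₀o.inter hO).preimage continuous_snd)
    have hset : ζf '' (B₀ ∩ O) = {t : ↥(Subgroup.centralizer ({γ} : Set ↥U)) |
        (t : ↥U) ∈ e '' (e.source ∩ Prod.snd ⁻¹' (B₀ ∩ O)) ∧ (((t : ↥U) : GL n E) : Matrix n n E) ∈ R} := by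
      ext t
      constructor
      · rintro ⟨b, ⟨hbB, hbO⟩, rfl⟩
        exact ⟨⟨(a₀, b), ⟨hB₀src b hbB, ⟨hbB, hbO⟩⟩, hea₀ b hbB⟩, hB₀R b hbB⟩
      · rintro ⟨⟨p, ⟨hps, hpB, hpO⟩, hpt⟩, htR⟩
        refine ⟨p.2, ⟨hpB, hpO⟩, ?_⟩
        apply Subtype.ext
        show τ p.2 = (t : ↥U)
        have h1 : (t : ↥U) = s p.1 * τ p.2 * (s p.1)⁻¹ := by rw [← hpt, he p hps]
        have key := hR (mk_mem_prod (hRsub htR).1 (hRsub (hB₀R p.2 hpB)).2)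
        have hcommute : Commute (((t : ↥U) : GL n E) : Matrix n n E) (((τ p.2 : ↥U) : GL n E) : Matrix n n E) := by
          have ht : (t : ↥U) ∈ Subgroup.centralizer ({τ p.2} : Set ↥U) := by
            rw [(hreg₀ p.2 hpB).2]
            exact t.2
          rw [Subgroup.mem_centralizer_singleton_iff] at ht
          have h' := congrArg (fun g : ↥U => ((g : GL n E) : Matrix n n E)) ht
          simp only [Subgroup.coe_mul, Units.val_mul] at h'
          exact h'
        have hchar : (((τ p.2 : ↥U) : GL n E) : Matrix n n E).charpoly = (((t : ↥U) : GL n E) : Matrix n n E).charpoly := by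
          rw [h1, Subgroup.coe_mul, Subgroup.coe_mul, Subgroup.coe_inv, Units.val_mul, Units.val_mul, Matrix.coe_units_inv,
            Matrix.charpoly_units_conj]
        exact (Subtype.ext (Units.ext (key hcommute hchar))).symm
    rw [hset]
    exact (hVo.preimage continuous_subtype_val).inter
      (hRo.preimage (Units.continuous_val.comp (continuous_subtype_val.comp continuous_subtype_val)))
  refine ⟨B₀, OpenPartialHomeomorph.ofContinuousOpenRestrict (hinj.toPartialEquiv ζf B₀) (by exact hζc.continuousOn) (by exact hopen) hB₀o,
    hB₀o, hbB₀, hB₀src, rfl, fun b => rfl⟩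

/-- **N6ns-reg-(iv) CM DRESS, FIELD LEVEL, TORUS COORDINATES.** From an abstract chart datum with box clause `(e, s, τ)` on `U ≤ GL_n(E)` around the regular
semisimple `γ = τ b₀` (`e = s·τ·s⁻¹` on its source, `s a₀ = 1`, `τ(B) ⊆ Z_U(γ)`): an `OpenPartialHomeomorph eᵀ : A × ↥Z_U(γ) → U` with
`eᵀ(a, t) = s(a) · t · s(a)⁻¹` on its source, a base point `(a₀, t₀)`, `t₀ = γ`, and inside EVERY neighbourhood of `(a₀, t₀)` a compact-open box `K × B₁ ⊆ eᵀ.source`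
with (reg) `χ(t)` separable ∧ `Z_U(t) = Z_U(γ)`, (SAT) `x t x⁻¹ ∈ eᵀ(K × B₁) ⇒ x ∈ s(K)·Z_U(γ)`, (SEP) `t ∼_{GL_n(E)} t′ ⇒ t = t′` — the torus coordinate IS
the inclusion of the centraliser (F0P2-p02's junction shape `B := ↥(Subgroup.centralizer {γ})`, `τ := Subtype.val`).
[cite: HarishChandra1970, Part I §3] [cite: Rogawski1990, §3.1 p. 19; §4.3 p. 43] -/
theorem exists_torus_chartDatum_of_chartDatum [Nonempty B] {γ : ↥U} (hγ : ((γ : GL n E) : Matrix n n E).charpoly.Separable)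
    (s : A → ↥U) (τ : B → ↥U) (hτ : Continuous τ) (e : OpenPartialHomeomorph (A × B) ↥U)
    (he : ∀ p ∈ e.source, e p = s p.1 * τ p.2 * (s p.1)⁻¹) {a₀ : A} {b₀ : B}
    (hs₀ : s a₀ = 1) (hτ₀ : τ b₀ = γ) (hcomm : ∀ b, τ b ∈ Subgroup.centralizer ({γ} : Set ↥U))
    (hbox : ∀ N ∈ 𝓝 (a₀, b₀), ∃ (K : Set A) (B₁ : Set B), IsCompact K ∧ IsOpen K ∧ a₀ ∈ K ∧ IsCompact B₁ ∧ IsOpen B₁ ∧ b₀ ∈ B₁ ∧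
      K ×ˢ B₁ ⊆ N ∧ K ×ˢ B₁ ⊆ e.source ∧
      (∀ b ∈ B₁, (((τ b : ↥U) : GL n E) : Matrix n n E).charpoly.Separable ∧
        Subgroup.centralizer ({τ b} : Set ↥U) = Subgroup.centralizer ({γ} : Set ↥U)) ∧
      (∀ b ∈ B₁, ∀ x : ↥U, x * τ b * x⁻¹ ∈ e '' (K ×ˢ B₁) →
        x ∈ s '' K * (Subgroup.centralizer ({γ} : Set ↥U) : Set ↥U)) ∧
      (∀ b ∈ B₁, ∀ b' ∈ B₁, IsConj ((τ b : ↥U) : GL n E) ((τ b' : ↥U) : GL n E) → b = b')) :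
    ∃ (eT : OpenPartialHomeomorph (A × ↥(Subgroup.centralizer ({γ} : Set ↥U))) ↥U) (t₀ : ↥(Subgroup.centralizer ({γ} : Set ↥U))),
      (t₀ : ↥U) = γ ∧ (a₀, t₀) ∈ eT.source ∧
      (∀ p ∈ eT.source, eT p = s p.1 * (p.2 : ↥U) * (s p.1)⁻¹) ∧
      ∀ N ∈ 𝓝 (a₀, t₀), ∃ (K : Set A) (B₁ : Set ↥(Subgroup.centralizer ({γ} : Set ↥U))),
        IsCompact K ∧ IsOpen K ∧ a₀ ∈ K ∧ IsCompact B₁ ∧ IsOpen B₁ ∧ t₀ ∈ B₁ ∧ K ×ˢ B₁ ⊆ N ∧ K ×ˢ B₁ ⊆ eT.source ∧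
        (∀ t ∈ B₁, ((((t : ↥U)) : GL n E) : Matrix n n E).charpoly.Separable ∧
          Subgroup.centralizer ({(t : ↥U)} : Set ↥U) = Subgroup.centralizer ({γ} : Set ↥U)) ∧
        (∀ t ∈ B₁, ∀ x : ↥U, x * (t : ↥U) * x⁻¹ ∈ eT '' (K ×ˢ B₁) →
          x ∈ s '' K * (Subgroup.centralizer ({γ} : Set ↥U) : Set ↥U)) ∧
        (∀ t ∈ B₁, ∀ t' ∈ B₁, IsConj (((t : ↥U)) : GL n E) (((t' : ↥U)) : GL n E) → t = t') := by
  obtain ⟨B₀, ζ, hB₀o, hbB₀, hB₀src, hζs, hζval⟩ :=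
    exists_openPartialHomeomorph_torusCoordinate hγ s τ hτ e he hs₀ hτ₀ hcomm hbox
  have hζfun : (ζ : B → ↥(Subgroup.centralizer ({γ} : Set ↥U))) = fun b => ⟨τ b, hcomm b⟩ :=
    funext fun b => Subtype.ext (hζval b)
  have hζc : Continuous (ζ : B → ↥(Subgroup.centralizer ({γ} : Set ↥U))) := by
    rw [hζfun]
    exact hτ.subtype_mk _
  have hbζ : b₀ ∈ ζ.source := by rw [hζs]; exact hbB₀
  -- the re-coordinatised chart
  refine ⟨((OpenPartialHomeomorph.refl A).prod ζ.symm).trans e, ζ b₀, by rw [hζval, hτ₀], ?_, ?_, ?_⟩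
  · -- base point in the source
    rw [OpenPartialHomeomorph.trans_source, OpenPartialHomeomorph.prod_source, OpenPartialHomeomorph.refl_source, ζ.symm_source]
    refine ⟨mk_mem_prod (mem_univ _) (ζ.map_source hbζ), ?_⟩
    show (a₀, ζ.symm (ζ b₀)) ∈ e.source
    rw [ζ.left_inv hbζ]
    exact hB₀src b₀ hbB₀
  · -- the formula on the source
    intro p hp
    rw [OpenPartialHomeomorph.trans_source, OpenPartialHomeomorph.prod_source, OpenPartialHomeomorph.refl_source, ζ.symm_source] at hp
    have hp2 : p.2 ∈ ζ.target := hp.1.2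
    have hps : (p.1, ζ.symm p.2) ∈ e.source := hp.2
    show e (p.1, ζ.symm p.2) = _
    rw [he _ hps]
    show s p.1 * τ (ζ.symm p.2) * (s p.1)⁻¹ = s p.1 * (p.2 : ↥U) * (s p.1)⁻¹
    rw [← hζval (ζ.symm p.2), ζ.right_inv hp2]
  · -- the box clause in torus coordinates
    intro N hN
    have hΘ : Continuous fun q : A × B => (q.1, ζ q.2) := continuous_fst.prodMk (hζc.comp continuous_snd)
    have hN' : (fun q : A × B => (q.1, ζ q.2)) ⁻¹' N ∩ univ ×ˢ B₀ ∈ 𝓝 (a₀, b₀) :=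
      inter_mem (hΘ.continuousAt.preimage_mem_nhds hN) (prod_mem_nhds univ_mem (hB₀o.mem_nhds hbB₀))
    obtain ⟨K, B₁, hKc, hKo, haK, hB₁c, hB₁o, hbB, hKBN, hKBs, hreg, hsat, hsep⟩ := hbox _ hN'
    have hB₁B₀ : B₁ ⊆ B₀ := fun b hb => (hKBN (mk_mem_prod haK hb)).2.2
    have hB₁ζ : B₁ ⊆ ζ.source := by rw [hζs]; exact hB₁B₀
    have hsrcT : ∀ a b, (a, b) ∈ e.source → b ∈ B₀ → (a, ζ b) ∈ (((OpenPartialHomeomorph.refl A).prod ζ.symm).trans e).source := by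
      intro a b hab hb
      have hbs : b ∈ ζ.source := by rw [hζs]; exact hb
      rw [OpenPartialHomeomorph.trans_source, OpenPartialHomeomorph.prod_source, OpenPartialHomeomorph.refl_source, ζ.symm_source]
      refine ⟨mk_mem_prod (mem_univ _) (ζ.map_source hbs), ?_⟩
      show (a, ζ.symm (ζ b)) ∈ e.source
      rw [ζ.left_inv hbs]
      exact hab
    refine ⟨K, ζ '' B₁, hKc, hKo, haK, hB₁c.image hζc, ζ.isOpen_image_of_subset_source hB₁o hB₁ζ, ⟨b₀, hbB, rfl⟩, ?_, ?_, ?_, ?_, ?_⟩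
    · rintro ⟨a, t⟩ ⟨ha, ⟨b, hb, rfl⟩⟩
      exact (hKBN (mk_mem_prod ha hb)).1
    · rintro ⟨a, t⟩ ⟨ha, ⟨b, hb, rfl⟩⟩
      exact hsrcT a b (hKBs (mk_mem_prod ha hb)) (hB₁B₀ hb)
    · rintro t ⟨b, hb, rfl⟩
      rw [hζval]
      exact hreg b hb
    · rintro t ⟨b, hb, rfl⟩ x hx
      obtain ⟨⟨a, t'⟩, ⟨ha, ⟨b', hb', rfl⟩⟩, hpx⟩ := hx
      have hb's : b' ∈ ζ.source := hB₁ζ hb'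
      have hpx' : e (a, b') = x * τ b * x⁻¹ := by
        rw [← hζval b, ← hpx]
        show e (a, b') = e (a, ζ.symm (ζ b'))
        rw [ζ.left_inv hb's]
      exact hsat b hb x ⟨(a, b'), mk_mem_prod ha hb', hpx'⟩
    · rintro t ⟨b, hb, rfl⟩ t' ⟨b', hb', rfl⟩ h
      rw [hζval, hζval] at h
      rw [hsep b hb b' hb' h]

end Subgroup

end Literature.NumberTheory.Automorphic

end
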